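import Summits.Langlands.Langlands.Theses.RamifiedCoefficientSeed
import Summits.Langlands.Langlands.Theses.PrimeSwitchSplit
import HarnessLib

/-!
# Birth skeleton (BC3) for the split child `PadicMemberCompatibility` of `RamifiedCoefficientSeed.SectorComplement`
(crux-strategist cstrat-stmt-Langlands-16781-r1, 2026-08-17; child item: stmt-Langlands-17534 (verbatim; attached child of 16781))

P = (i) the irreducible Satake avatar is de Rham above `ℓ` ∧ (ii) the prime-switch principle.  Split (i)/(ii) (route
PrimeSwitchSplit's foreseen layer-2 split of this very item, "P ⇐ DeRhamMember → CrossPrimeClass"): (i) de Rham-ness of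
automorphic Galois representations (A'Campo 2024; AHTW 2026 Thm. 1.2.1 for regular `π` over CM; open for irregular `π` /
general `K`); (ii) Fontaine's `C_WD` for the automorphic compatible system (Saito for Hilbert modular forms, Caraiani for
Shimura varieties, AHTW up to semisimplification; the monodromy operator is the open residue; formally the ramified sector waits
for definition item D2 of `FontaineDpst`).

BY-NAME VERSION: the child item is SHARED — it is stmt-level identical to `Summit.Langlands.Langlands.Theses.PrimeSwitchSplit.PadicMemberCompatibility`
(an existing decl), so this skeleton concludes THAT decl by name (`open … PrimeSwitchSplit (PadicMemberCompatibility)`); after `route edit --split` the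
homonymous `RamifiedCoefficientSeed.PadicMemberCompatibility` is definitionally the same term.  Register with
`ledger skeleton check <this file> --crux <child item> --crux-decl Summit.Langlands.Langlands.Theses.PrimeSwitchSplit.PadicMemberCompatibility`.
`lean check`: rc 0, sorries = the `stub_*` only; `PadicMemberCompatibility_of` concludes the child BY NAME.
-/

noncomputable section

set_option linter.dupNamespace false

namespace Summit.Langlands.Langlands.Cruxes.SectorComplement.BirthPadicMemberCompatibility

open scoped NumberField Classical Topology
open Filter IsDedekindDomain
open Literature.NumberTheory.Automorphic Literature.NumberTheory.GaloisRepresentations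
open Summit.Langlands

open Summit.Langlands.Langlands.Theses.PrimeSwitchSplit (PadicMemberCompatibility)

/-- **stub DE RHAM MEMBER** — P(i): an irreducible `ℓ`-adic avatar (Satake–Frobenius compatible a.e.) of an L-algebraic
cuspidal `π` is de Rham at every `v ∣ ℓ` for Fontaine's pinned datum (A'Campo 2024; A'Campo–Hevesi–Thorne–Whitmore 2026
Thm. 1.2.1, regular `π` over CM; Literature fact `AHTW2026.deRham_hodgeTateRegular` for that sector).  OPEN for irregular `π`
and general `K`.  Size open-problem.  [cite: AHTW2026, Thm. 1.2.1] [cite: FontaineMazurGeometric1995, §1] -/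
theorem stub_deRhamMember : ∀ (K : Type) [Field K] [NumberField K] (n : ℕ) (hcpt : Literature.NumberTheory.Automorphic.isCompact_glFiniteIntegralLevel n K), 0 < n → ∀ (π : Literature.NumberTheory.Automorphic.CuspidalAutomorphicRepData n K hcpt), π.1.IsLAlgebraic → ∀ (ℓ : ℕ) [Fact ℓ.Prime] (ι : PadicAlgCl ℓ ≃+* ℂ) (ρ : Literature.NumberTheory.GaloisRepresentations.FramedGaloisRep K (PadicAlgCl ℓ) n), ρ.toGaloisRep.IsIrreducible → (∀ᶠ v : IsDedekindDomain.HeightOneSpectrum (NumberField.RingOfIntegers K) in cofinite, SatakeFrobCompatibleAt ι π.1 ρ v) → ∀ (v : IsDedekindDomain.HeightOneSpectrum (NumberField.RingOfIntegers K)) (hv : ((ℓ : ℕ) : NumberField.RingOfIntegers K) ∈ v.asIdeal), (Literature.NumberTheory.PAdicHodge.fontainePstAdicCompletion v ℓ hv).IsDeRhamFramed (ρ.toLocal v) := by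
  sorry

/-- **stub CROSS-PRIME CLASS** — P(ii), the prime switch: for `v ∣ ℓ`, every datum `Rec`, every prime `ℓ' ∤ v` and every
irreducible `ℓ'`-adic avatar `ρ'` of `(π, ι')`, local–global compatibility of `(π, ρ')` at `v` implies that of `(π, ρ)` at
`v` (Fontaine's `C_WD` for the system `{ρ_(π,ι)}` at `v`: `Rec` cancels, both sides name `rec_v(π_v)`; Saito
arXiv:math/0612077, Caraiani 2012/2014, AHTW 2026 up to semisimplification).  Why it might fail: the monodromy operator `N`
at `p` for torsion-limit representations is open; formally the ramified sector waits for D2 (`WD ∘ D_pst` pinned only on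
unramified `ρ`, clause F8).  Size open-problem.  [cite: FontaineAsterisque223VIII, §2.3.7] [cite: Caraiani2014, Thm. 1.1] -/
theorem stub_crossPrimeClass : ∀ (K : Type) [Field K] [NumberField K] (n : ℕ) (hcpt : Literature.NumberTheory.Automorphic.isCompact_glFiniteIntegralLevel n K), 0 < n → ∀ (π : Literature.NumberTheory.Automorphic.CuspidalAutomorphicRepData n K hcpt), π.1.IsLAlgebraic → ∀ (ℓ : ℕ) [Fact ℓ.Prime] (ι : PadicAlgCl ℓ ≃+* ℂ) (ρ : Literature.NumberTheory.GaloisRepresentations.FramedGaloisRep K (PadicAlgCl ℓ) n), ρ.toGaloisRep.IsIrreducible → (∀ᶠ v : IsDedekindDomain.HeightOneSpectrum (NumberField.RingOfIntegers K) in cofinite, SatakeFrobCompatibleAt ι π.1 ρ v) → ∀ (v : IsDedekindDomain.HeightOneSpectrum (NumberField.RingOfIntegers K)) (hv : ((ℓ : ℕ) : NumberField.RingOfIntegers K) ∈ v.asIdeal), ∀ (Rec : ReciprocityData K) (ℓ' : ℕ) [Fact ℓ'.Prime] (ι' : PadicAlgCl ℓ' ≃+* ℂ) (ρ' : Literature.NumberTheory.GaloisRepresentations.FramedGaloisRep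 K (PadicAlgCl ℓ') n), ((ℓ' : ℕ) : NumberField.RingOfIntegers K) ∉ v.asIdeal → ρ'.toGaloisRep.IsIrreducible → (∀ᶠ w : IsDedekindDomain.HeightOneSpectrum (NumberField.RingOfIntegers K) in cofinite, SatakeFrobCompatibleAt ι' π.1 ρ' w) → LocalGlobalCompatibleAt Rec ι' π.1 ρ' v → LocalGlobalCompatibleAt Rec ι π.1 ρ v := by
  sorry

namespace _Goal

/-- The statement of `stub_deRhamMember` (literally its type). [folklore] -/
def stub_deRhamMember : Prop :=
  type_of% @Summit.Langlands.Langlands.Cruxes.SectorComplement.BirthPadicMemberCompatibility.stub_deRhamMember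

/-- The statement of `stub_crossPrimeClass` (literally its type). [folklore] -/
def stub_crossPrimeClass : Prop :=
  type_of% @Summit.Langlands.Langlands.Cruxes.SectorComplement.BirthPadicMemberCompatibility.stub_crossPrimeClass

end _Goal

/-- **P from its two stubs** (the conjunction). -/
theorem PadicMemberCompatibility_of (h1 : _Goal.stub_deRhamMember) (h2 : _Goal.stub_crossPrimeClass) : PadicMemberCompatibility := by
  dsimp only [_Goal.stub_deRhamMember, _Goal.stub_crossPrimeClass] at h1 h2
  intro K _ _ n hcpt hn π hL ℓ _ ι ρ hirr hρ v hv
  exact ⟨h1 K n hcpt hn π hL ℓ ι ρ hirr hρ v hv, h2 K n hcpt hn π hL ℓ ι ρ hirr hρ v hv⟩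

/-- by-name sanity check -/
example : PadicMemberCompatibility := PadicMemberCompatibility_of stub_deRhamMember stub_crossPrimeClass

end Summit.Langlands.Langlands.Cruxes.SectorComplement.BirthPadicMemberCompatibility

end
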